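import Summits.Ventures.Crystal3D.Theorems.StickyWulffConstantCoaxialWallLawSeamSealedRowZTermKit
import HarnessLib

/-!
# Z-TERM KIT, part B: the module Gram obstruction, closure invariants, counting lemmas for the cap table
# (crux `CoaxialWallLaw`, stmt-Ventures-19481; line `WallLedgerF`, skeleton 'CoaxialWallLawCertificates' v8.3; toward the refutation of the
# registered input `stub_unionCoreSealedCapWin3 : TailResidue.UnionCoreSealedCapWin₃ (2 * Real.sqrt 6)` by the UNFLOORED PAYER TERM)

HONEST FRAMING. Venture `Summits/Ventures/Crystal3D` (cell `crystal3d-full`), helper `--supports` stmt-Ventures-19481.  Plumbing only, for the sequel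
'…SeamSealedRowZTerm*': there an explicit 21-ball window `Y` (payer `0` the target of FIVE narrow movers, eight single-contact junk balls) has
`sealedSummand₃ = 5 > 2√6`, because `sealedPool₃` floors the pool at `3` only for `b ≠ z`.  This file provides
(part A, '…SeamSealedRowZTermKit': `cubicVecQ` algebra, cube normals, `{111}` reflections.)  This part:
* §4 the MODULE GRAM OBSTRUCTION: `⟪x, y⟫ ∈ (1/12)ℤ` for `x, y ∈ coaxialModule 1 √(2/3)` (`inner_module_twelfth`), and its site / star-site corollaries;
* §5 closure invariants: `capClosure`/`starClosure` stay inside any cap-closed or star-closed superset of the seed; a seed without unit triangles is cap-closed already;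
  an (A)-end pair of a set forces a unit triangle in it (`exists_triangle_of_isEndPairA`);
* §6 counting: occupied slot patterns bound the contact number from below (`card_slots_le_card_contacts`), hence `4 ≤ capTable₃` at `≤ 7` core contacts and
  `capTable₃ = 12 − deg` at `≤ 5` core contacts without a closed star.
WHAT THIS IS NOT: no statement about any stub; F-C1 not moved.
-/

noncomputable section

namespace Summit.Ventures.Crystal3D.Theorems

namespace ZTerm

open Summit.Ventures.Crystal3D Finset NearIdentity TailResidue
open scoped InnerProductSpace

/-! ### §4 The module Gram obstruction -/

open Literature.MathematicalPhysics.StatisticalMechanics (triangularVec₁ triangularVec₂ barlowOffset layerNormal)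

/-- The rational cubic coordinates of the module combination `i u + j v + n w + k (h e₃)`. -/
def modQ (i j n k : ℤ) : Fin 3 → ℚ := ![(i : ℚ) + j + (2 * n - 2 * k) / 3, (i : ℚ) + (n + 2 * k) / 3, (j : ℚ) + (n + 2 * k) / 3]

/-- Cubic coordinates of `u = (1, 0, 0)`. -/
theorem cubicCoords_triangularVec₁ : cubicCoords (triangularVec₁ 1) = fun t => ((![1, 1, 0] : Fin 3 → ℚ) t : ℝ) / Real.sqrt 2 := by
  ext t; fin_cases t <;> simp [cubicCoords, triangularVec₁]

/-- Cubic coordinates of `v = (1/2, √3/2, 0)`. -/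
theorem cubicCoords_triangularVec₂ : cubicCoords (triangularVec₂ 1) = fun t => ((![1, 0, 1] : Fin 3 → ℚ) t : ℝ) / Real.sqrt 2 := by
  ext t; fin_cases t <;> simp [cubicCoords, triangularVec₂] <;> field_simp <;> nlinarith [Real.mul_self_sqrt (show (0:ℝ) ≤ 3 by norm_num)]

/-- Cubic coordinates of `w = (1/2, √3/6, 0)`. -/
theorem cubicCoords_barlowOffset : cubicCoords (barlowOffset 1) = fun t => ((![2 / 3, 1 / 3, 1 / 3] : Fin 3 → ℚ) t : ℝ) / Real.sqrt 2 := by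
  ext t; fin_cases t <;> simp [cubicCoords, barlowOffset] <;> field_simp <;> nlinarith [Real.mul_self_sqrt (show (0:ℝ) ≤ 3 by norm_num)]

/-- Cubic coordinates of `h e₃ = (0, 0, √(2/3))`. -/
theorem cubicCoords_layerNormal : cubicCoords (layerNormal (Real.sqrt (2 / 3))) = fun t => ((![-2 / 3, 2 / 3, 2 / 3] : Fin 3 → ℚ) t : ℝ) / Real.sqrt 2 := by
  have h2 : Real.sqrt 2 ^ 2 = 2 := Real.sq_sqrt (by norm_num)
  have h3 : Real.sqrt 3 ^ 2 = 3 := Real.sq_sqrt (by norm_num)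
  ext t; fin_cases t <;> simp [cubicCoords, layerNormal] <;> field_simp <;> nlinarith [Real.mul_self_sqrt (show (0:ℝ) ≤ 2 / 3 by norm_num), h2, h3]

/-- **Module points are rational cubic vectors**: `i u + j v + n w + k h e₃ = cubicVecQ (modQ i j n k)`. -/
theorem module_eq_cubicVecQ (i j n k : ℤ) :
    (i : ℝ) • triangularVec₁ 1 + (j : ℝ) • triangularVec₂ 1 + (n : ℝ) • barlowOffset 1 + (k : ℝ) • layerNormal (Real.sqrt (2 / 3)) =
      cubicVecQ (modQ i j n k) := by
  apply cubicCoords_injective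
  rw [cubicCoords_add, cubicCoords_add, cubicCoords_add, cubicCoords_smul, cubicCoords_smul, cubicCoords_smul, cubicCoords_smul,
    cubicCoords_triangularVec₁, cubicCoords_triangularVec₂, cubicCoords_barlowOffset, cubicCoords_layerNormal, cubicCoords_cubicVecQ]
  ext t; fin_cases t <;> simp [modQ] <;> ring

/-- A module point has a `modQ` presentation. -/
theorem exists_modQ_of_mem {x : EuclideanSpace ℝ (Fin 3)} (hx : x ∈ coaxialModule 1 (Real.sqrt (2 / 3))) : ∃ i j n k : ℤ, x = cubicVecQ (modQ i j n k) := by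
  obtain ⟨i, j, n, k, rfl⟩ := hx
  exact ⟨i, j, n, k, module_eq_cubicVecQ i j n k⟩

/-- **THE MODULE GRAM OBSTRUCTION**: inner products of module vectors lie in `(1/12)ℤ`. -/
theorem inner_module_twelfth {x y : EuclideanSpace ℝ (Fin 3)} (hx : x ∈ coaxialModule 1 (Real.sqrt (2 / 3))) (hy : y ∈ coaxialModule 1 (Real.sqrt (2 / 3))) :
    ∃ N : ℤ, ⟪x, y⟫_ℝ = (N : ℝ) / 12 := by
  obtain ⟨i, j, n, k, rfl⟩ := exists_modQ_of_mem hx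
  obtain ⟨i', j', n', k', rfl⟩ := exists_modQ_of_mem hy
  refine ⟨12 * i * i' + 6 * (i * j' + j * i') + 12 * j * j' + 6 * (i * n' + n * i') + 6 * (j * n' + n * j') + 4 * n * n' + 8 * k * k', ?_⟩
  rw [inner_cubicVecQ]
  simp [qdot, modQ]
  ring

/-- **Three sites of one placement**: if `x, y, y'` are module sites of the placement `(c, S)` then `12⟪x − y, y' − y⟫ ∈ ℤ`. -/
theorem inner_sites_twelfth (S : EuclideanSpace ℝ (Fin 3) ≃ₗᵢ[ℝ] EuclideanSpace ℝ (Fin 3)) {c x y y' : EuclideanSpace ℝ (Fin 3)}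
    (hx : S.symm (x - c) ∈ coaxialModule 1 (Real.sqrt (2 / 3))) (hy : S.symm (y - c) ∈ coaxialModule 1 (Real.sqrt (2 / 3)))
    (hy' : S.symm (y' - c) ∈ coaxialModule 1 (Real.sqrt (2 / 3))) : ∃ N : ℤ, ⟪x - y, y' - y⟫_ℝ = (N : ℝ) / 12 := by
  have h1 : S.symm (x - y) ∈ coaxialModule 1 (Real.sqrt (2 / 3)) := by
    have e : S.symm (x - y) = S.symm (x - c) - S.symm (y - c) := by rw [← map_sub]; congr 1; abel
    rw [e]; exact sub_mem_module hx hy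
  have h2 : S.symm (y' - y) ∈ coaxialModule 1 (Real.sqrt (2 / 3)) := by
    have e : S.symm (y' - y) = S.symm (y' - c) - S.symm (y - c) := by rw [← map_sub]; congr 1; abel
    rw [e]; exact sub_mem_module hy' hy
  obtain ⟨N, hN⟩ := inner_module_twelfth h1 h2
  exact ⟨N, by rw [← hN, LinearIsometryEquiv.inner_map_map]⟩

/-- **A star site pairs integrally with its star**: if `x` is a star site of `D` then for the star centre `y ∈ D` and some star ball `y₁ ∈ D`, `y₁ ≠ y`,
`12⟪x − y, y₁ − y⟫ ∈ ℤ` (indeed `⟪A w, A δ⟫ = ⟪w, δ⟫ ∈ {0, ±½, ±1}`). -/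
theorem inner_starSite_twelfth {D : Finset (EuclideanSpace ℝ (Fin 3))} {x : EuclideanSpace ℝ (Fin 3)} (h : StarSiteIn D x) :
    ∃ y ∈ D, ∃ y₁ ∈ D, y₁ ≠ y ∧ ∃ N : ℤ, ⟪x - y, y₁ - y⟫_ℝ = (N : ℝ) / 12 := by
  obtain ⟨y, hy, A, δ, hδ, hstar, w, hw, rfl⟩ := h
  have hδδ : 0 < ⟪δ, δ⟫_ℝ := by rw [real_inner_self_eq_norm_sq, norm_eq_one_of_mem_fccSlots hδ]; norm_num
  refine ⟨y, hy, y + A δ, hstar δ hδ hδδ, ?_, ?_⟩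
  · intro h
    have h0 : A δ = 0 := by simpa using h
    have hn : ‖A δ‖ = 1 := by rw [A.norm_map, norm_eq_one_of_mem_fccSlots hδ]
    rw [h0, norm_zero] at hn
    exact zero_ne_one hn
  · rw [add_sub_cancel_left, add_sub_cancel_left, LinearIsometryEquiv.inner_map_map]
    rcases inner_slots_mem hw hδ with h | h | h | h | h <;> rw [h]
    · exact ⟨12, by norm_num⟩
    · exact ⟨6, by norm_num⟩
    · exact ⟨0, by norm_num⟩
    · exact ⟨-6, by norm_num⟩
    · exact ⟨-12, by norm_num⟩

/-! ### §5 Closure invariants -/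

/-- **The capping closure stays inside a cap-closed superset of the seed.** -/
theorem capClosure_subset_of_closed {W D₀ K : Finset (EuclideanSpace ℝ (Fin 3))} (h0 : D₀ ⊆ K) (hK : ∀ x ∈ W, CapsTriangleIn K x → x ∈ K) :
    capClosure W D₀ ⊆ K := by
  classical
  suffices h : ∀ n, capIter W D₀ n ⊆ K from h _
  intro n
  induction n with
  | zero => exact h0
  | succ n ih =>
    intro x hx
    rw [capIter_succ, mem_capStep_iff] at hx
    rcases hx with hx | ⟨hxW, hcap⟩
    · exact ih hx
    · exact hK x hxW (hcap.mono ih)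

/-- **The star closure stays inside a cap- and star-closed superset of the seed.** -/
theorem starClosure_subset_of_closed {W D₀ K : Finset (EuclideanSpace ℝ (Fin 3))} (h0 : D₀ ⊆ K) (hK : ∀ x ∈ W, CapsTriangleIn K x → x ∈ K)
    (hS : ∀ x ∈ W, StarSiteIn K x → x ∈ K) : starClosure W D₀ ⊆ K := by
  classical
  suffices h : ∀ n, starIter W D₀ n ⊆ K from h _
  intro n
  induction n with
  | zero => exact h0
  | succ n ih =>
    intro x hx
    rw [starIter_succ, mem_starStep_iff] at hx
    rcases hx with hx | ⟨hxW, hcap | hst⟩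
    · exact ih hx
    · exact hK x hxW (hcap.mono ih)
    · exact hS x hxW (hst.mono ih)

/-- A set WITHOUT unit triangles is its own capping closure. -/
theorem capClosure_eq_of_no_triangle {W T : Finset (EuclideanSpace ℝ (Fin 3))}
    (h : ∀ a ∈ T, ∀ b ∈ T, ∀ c ∈ T, ¬ (dist a b = 1 ∧ dist a c = 1 ∧ dist b c = 1)) : capClosure W T = T := by
  classical
  refine Subset.antisymm (capClosure_subset_of_closed Subset.rfl fun x _ hcap => ?_) (subset_capClosure _)
  obtain ⟨a, ha, b, hb, c, hc, hab, hac, hbc, -, -, -⟩ := hcap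
  exact absurd ⟨hab, hac, hbc⟩ (h a ha b hb c hc)

/-- **An (A)-end pair of `P` forces a unit triangle in `P`** (the reading at the mover: FULL, NARROW or TWIN — each occupies two adjacent slots around `q`). -/
theorem exists_triangle_of_isEndPairA {P : Finset (EuclideanSpace ℝ (Fin 3))} {v : WordVersion} {S₁ S₂ : PlateSystem} {b q : EuclideanSpace ℝ (Fin 3)}
    (h : IsEndPairA P v S₁ S₂ b q) : ∃ a ∈ P, ∃ a' ∈ P, ∃ a'' ∈ P, dist a a' = 1 ∧ dist a a'' = 1 ∧ dist a' a'' = 1 := by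
  obtain ⟨hq, -, -, G, d, -, -, hmove⟩ := h
  -- a twin reading at `q` gives a triangle
  have twin : ∀ m, IsTwinReading P G m q → ∃ a ∈ P, ∃ a' ∈ P, ∃ a'' ∈ P, dist a a' = 1 ∧ dist a a'' = 1 ∧ dist a' a'' = 1 := by
    intro m htw
    obtain ⟨hm, hlow, -, -⟩ := htw
    obtain ⟨u₁, hu₁, u₂, hu₂, u₃, hu₃, p1, -, -, -, -, -, -, -⟩ := exists_far_frame G hm.1 hm.2
    have hn1 : -u₁ ∈ fccSlots := neg_mem_fccSlots hu₁
    have hle : ⟪G (-u₁), m⟫_ℝ ≤ 0 := by rw [map_neg, inner_neg_left, p1]; exact neg_nonpos.2 (Real.sqrt_nonneg _)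
    obtain ⟨w₁, hw₁, w₂, hw₂, i1, i2, i12, l1, l2⟩ := exists_lower_slot_triangle G hm hn1 hle
    exact ⟨q + G (-u₁), hlow _ hn1 hle, q + G w₁, hlow _ hw₁ l1, q + G w₂, hlow _ hw₂ l2, dist_frame_slots_eq_one G q hn1 hw₁ i1,
      dist_frame_slots_eq_one G q hn1 hw₂ i2, dist_frame_slots_eq_one G q hw₁ hw₂ i12⟩
  rcases hmove with ⟨hrd, -, -⟩ | ⟨m, htw, -, -, -⟩
  · rcases hrd with hfull | ⟨-, hnar⟩ | ⟨m, htw, -⟩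
    · -- full: slots 0 and 4 are adjacent, slot 8 adjacent to both (cubic (1,1,0), (1,0,1), (0,1,1))
      refine ⟨q + G (slotSite 0), hfull _ (slotSite_mem 0), q + G (slotSite 4), hfull _ (slotSite_mem 4), q + G (slotSite 8), hfull _ (slotSite_mem 8),
        dist_frame_slots_eq_one G q (slotSite_mem 0) (slotSite_mem 4) (inner_slotSite_eq_half_of_dot (by decide)),
        dist_frame_slots_eq_one G q (slotSite_mem 0) (slotSite_mem 8) (inner_slotSite_eq_half_of_dot (by decide)),
        dist_frame_slots_eq_one G q (slotSite_mem 4) (slotSite_mem 8) (inner_slotSite_eq_half_of_dot (by decide))⟩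
    · obtain ⟨-, m, hm, -, hpos⟩ := hnar
      obtain ⟨u₁, hu₁, u₂, hu₂, u₃, hu₃, i12, i13, i23, p1, p2, p3⟩ := exists_upper_slot_triangle hm
      exact ⟨q + G u₁, hpos _ hu₁ p1, q + G u₂, hpos _ hu₂ p2, q + G u₃, hpos _ hu₃ p3, dist_frame_slots_eq_one G q hu₁ hu₂ i12,
        dist_frame_slots_eq_one G q hu₁ hu₃ i13, dist_frame_slots_eq_one G q hu₂ hu₃ i23⟩
    · exact twin m htw
  · exact twin m htw

/-! ### §6 Counting: slot patterns force contacts -/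

open scoped Classical in
/-- Occupied slots around `y` are distinct contacts of `y`. -/
theorem card_slots_le_card_contacts {D : Finset (EuclideanSpace ℝ (Fin 3))} {y : EuclideanSpace ℝ (Fin 3)} (s : Finset (Fin 12))
    (L : EuclideanSpace ℝ (Fin 3) ≃ₗᵢ[ℝ] EuclideanSpace ℝ (Fin 3)) (h : ∀ k ∈ s, y + L (slotSite k) ∈ D) :
    s.card ≤ (D.filter fun q => dist y q = 1).card := by
  refine Finset.card_le_card_of_injOn (fun k => y + L (slotSite k)) (fun k hk => ?_) ?_
  · rw [Finset.mem_coe, Finset.mem_filter]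
    exact ⟨h k hk, dist_slotSite_eq_one L y (slotSite_mem k)⟩
  · intro k₁ _ k₂ _ hk
    exact slotSite_injective (L.injective (add_left_cancel hk))

/-- The closed lower half-dozen has nine slots. -/
theorem card_lowerNine : lowerNine.card = 9 := by decide
/-- … and eight without the slot `0`. -/
theorem card_lowerNine_erase : (lowerNine.erase 0).card = 8 := by decide

open scoped Classical in
/-- **At a core ball with at most seven core contacts, `4 ≤ capTable₂`**: the rows eleven / ten / TEN′ / nine / hexagon−1 need `≥ 8` occupied slots, the hexagon
row reads `4`, the kissing row `≥ 5`. -/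
theorem four_le_capTable₂_of_card_le_seven {D : Finset (EuclideanSpace ℝ (Fin 3))} {y : EuclideanSpace ℝ (Fin 3)} (h7 : (D.filter fun q => dist y q = 1).card ≤ 7) :
    4 ≤ capTable₂ D y := by
  have nine : ∀ L, ¬ NinePat L D y := fun L hL => by
    have := card_slots_le_card_contacts lowerNine L hL; rw [card_lowerNine] at this; omega
  have ten : ∀ L, ¬ TenPat L D y := fun L hL => nine L hL.1
  have tenH : ∀ L, ¬ TenHcpPat L D y := fun L hL => nine L hL.1
  have eleven : ∀ L, ¬ ElevenPat L D y := fun L hL => by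
    have := card_slots_le_card_contacts (Finset.univ.erase 2) L (fun k hk => hL k (Finset.ne_of_mem_erase hk))
    rw [Finset.card_erase_of_mem (Finset.mem_univ _), Finset.card_univ, Fintype.card_fin] at this; omega
  have hexFive : ∀ L, ¬ HexFivePat L D y := fun L hL => by
    have := card_slots_le_card_contacts (lowerNine.erase 0) L (fun k hk => hL k (Finset.mem_of_mem_erase hk) (Finset.ne_of_mem_erase hk))
    rw [card_lowerNine_erase] at this; omega
  have hhex : 4 ≤ hexagonCap D y := by
    unfold hexagonCap patternCap; split_ifs <;> omega
  unfold capTable₂ capTable₁ capTable₀ hexFiveCap tenHcpCap nineCap tenCap elevenCap kissingCap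
  rw [patternCap_eq_twelve_of_forall_not eleven, patternCap_eq_twelve_of_forall_not ten, patternCap_eq_twelve_of_forall_not nine,
    patternCap_eq_twelve_of_forall_not tenH, patternCap_eq_twelve_of_forall_not hexFive]
  omega

open scoped Classical in
/-- `4 ≤ starCap` at a core ball with at most seven core contacts. -/
theorem four_le_starCap_of_card_le_seven {D : Finset (EuclideanSpace ℝ (Fin 3))} {y : EuclideanSpace ℝ (Fin 3)} (h7 : (D.filter fun q => dist y q = 1).card ≤ 7) :
    4 ≤ starCap D y := by
  unfold starCap; split_ifs <;> omega

open scoped Classical in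
/-- **`4 ≤ capTable₃` at `≤ 7` core contacts** (so the certified gain `(12 − deg − cap)⁺` is `≤ 1` at exactly `7`). -/
theorem four_le_capTable₃_of_card_le_seven {D : Finset (EuclideanSpace ℝ (Fin 3))} {y : EuclideanSpace ℝ (Fin 3)} (h7 : (D.filter fun q => dist y q = 1).card ≤ 7) :
    4 ≤ capTable₃ D y :=
  le_min (four_le_capTable₂_of_card_le_seven h7) (four_le_starCap_of_card_le_seven h7)

open scoped Classical in
/-- The five balls of a closed vertex star around `y` are five distinct contacts of `y`. -/
theorem five_le_card_contacts_of_star {D : Finset (EuclideanSpace ℝ (Fin 3))} {y : EuclideanSpace ℝ (Fin 3)} (A : EuclideanSpace ℝ (Fin 3) ≃ₗᵢ[ℝ] EuclideanSpace ℝ (Fin 3))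
    {δ : EuclideanSpace ℝ (Fin 3)} (hδ : δ ∈ fccSlots) (hstar : ∀ u ∈ fccSlots, 0 < ⟪u, δ⟫_ℝ → y + A u ∈ D) :
    5 ≤ (D.filter fun q => dist y q = 1).card := by
  rw [← card_star_eq_five hδ]
  refine Finset.card_le_card_of_injOn (fun u => y + A u) (fun u hu => ?_) ?_
  · rw [Finset.mem_coe, Finset.mem_filter] at hu ⊢
    exact ⟨hstar u hu.1 hu.2, dist_slotSite_eq_one' A y hu.1⟩
  · intro u₁ _ u₂ _ h
    exact A.injective (add_left_cancel h)
  where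
  /-- distance-one form for a slot given by membership -/
  dist_slotSite_eq_one' (F : EuclideanSpace ℝ (Fin 3) ≃ₗᵢ[ℝ] EuclideanSpace ℝ (Fin 3)) (y : EuclideanSpace ℝ (Fin 3)) {w : EuclideanSpace ℝ (Fin 3)}
      (hw : w ∈ fccSlots) : dist y (y + F w) = 1 := dist_slotSite_eq_one F y hw

open scoped Classical in
/-- **No closed star at `≤ 4` core contacts.** -/
theorem starCap_eq_twelve_of_card_le_four {D : Finset (EuclideanSpace ℝ (Fin 3))} {y : EuclideanSpace ℝ (Fin 3)} (h4 : (D.filter fun q => dist y q = 1).card ≤ 4) :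
    starCap D y = 12 := by
  unfold starCap
  rw [if_neg]
  rintro ⟨A, δ, hδ, hstar⟩
  have := five_le_card_contacts_of_star A hδ hstar
  omega

open scoped Classical in
/-- **No closed star at exactly `≤ 5` core contacts two of which are ANTIPODAL about `y`**: the star would be all five contacts, but a closed vertex star lies
in an open hemisphere. -/
theorem starCap_eq_twelve_of_antipodal {D : Finset (EuclideanSpace ℝ (Fin 3))} {y : EuclideanSpace ℝ (Fin 3)} (h5 : (D.filter fun q => dist y q = 1).card ≤ 5)
    {x₁ x₂ : EuclideanSpace ℝ (Fin 3)} (hx₁ : x₁ ∈ D) (hx₂ : x₂ ∈ D) (hd₁ : dist y x₁ = 1) (hd₂ : dist y x₂ = 1) (hanti : x₁ - y = -(x₂ - y)) :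
    starCap D y = 12 := by
  unfold starCap
  rw [if_neg]
  rintro ⟨A, δ, hδ, hstar⟩
  -- the star is all of the (≤ 5) contacts
  set star := (fccSlots.filter fun u => 0 < ⟪u, δ⟫_ℝ) with hstar_def
  have himg : star.image (fun u => y + A u) = D.filter fun q => dist y q = 1 := by
    apply Finset.eq_of_subset_of_card_le
    · intro x hx
      obtain ⟨u, hu, rfl⟩ := Finset.mem_image.1 hx
      rw [hstar_def, Finset.mem_filter] at hu
      exact Finset.mem_filter.2 ⟨hstar u hu.1 hu.2, dist_slotSite_eq_one A y hu.1⟩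
    · rw [Finset.card_image_of_injective _ (fun u₁ u₂ h => A.injective (add_left_cancel h)), hstar_def, card_star_eq_five hδ]
      exact h5
  have hx₁' : x₁ ∈ star.image fun u => y + A u := by rw [himg]; exact Finset.mem_filter.2 ⟨hx₁, hd₁⟩
  have hx₂' : x₂ ∈ star.image fun u => y + A u := by rw [himg]; exact Finset.mem_filter.2 ⟨hx₂, hd₂⟩
  obtain ⟨u₁, hu₁, e₁⟩ := Finset.mem_image.1 hx₁'
  obtain ⟨u₂, hu₂, e₂⟩ := Finset.mem_image.1 hx₂'
  rw [hstar_def, Finset.mem_filter] at hu₁ hu₂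
  have hA : A u₁ = -A u₂ := by
    have e1 : x₁ - y = A u₁ := by rw [← e₁]; abel
    have e2 : x₂ - y = A u₂ := by rw [← e₂]; abel
    rw [← e1, ← e2]; exact hanti
  have hu : u₁ = -u₂ := A.injective (by rw [map_neg]; exact hA)
  have : ⟪u₁, δ⟫_ℝ = -⟪u₂, δ⟫_ℝ := by rw [hu, inner_neg_left]
  linarith [hu₁.2, hu₂.2]

open scoped Classical in
/-- **Certified gain zero**: at a core ball with `capTable₂ = 12 − deg` and `starCap = 12`, `capGain capTable₃ = 0`. -/
theorem capGain_capTable₃_eq_zero {D : Finset (EuclideanSpace ℝ (Fin 3))} {y : EuclideanSpace ℝ (Fin 3)} (h5 : (D.filter fun q => dist y q = 1).card ≤ 5)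
    (hstar : starCap D y = 12) : capGain capTable₃ D y = 0 := by
  unfold capGain capTable₃
  rw [capTable₂_eq_kissing_of_card_le_five h5, hstar, min_eq_left (by omega), Nat.cast_sub (by omega)]
  simp

open scoped Classical in
/-- **Certified gain at most one** at a core ball with exactly seven core contacts. -/
theorem capGain_capTable₃_le_one {D : Finset (EuclideanSpace ℝ (Fin 3))} {y : EuclideanSpace ℝ (Fin 3)} (h7 : (D.filter fun q => dist y q = 1).card = 7) :
    capGain capTable₃ D y ≤ 1 := by
  have h4 := four_le_capTable₃_of_card_le_seven h7.le
  unfold capGain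
  refine max_le zero_le_one ?_
  rw [h7]
  have : (4 : ℝ) ≤ (capTable₃ D y : ℝ) := by exact_mod_cast h4
  push_cast
  linarith

end ZTerm

end Summit.Ventures.Crystal3D.Theorems

end
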